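import Summits.QuantumFields.YangMills.Theorems.SwapVirialDeficitNearFlatBulk
import Summits.QuantumFields.YangMills.Theorems.SwapVirialDeficitBlowUpGnomonicSeamFloorCoords
import HarnessLib

/-!
# NEAR-FLAT PROJECTION IN GNOMONIC∕HUB LETTERS: for a bulk hub `a` (`re a ≠ 0`, `im a ≠ 0`) every chart point `(a, ε, η)` is within
# `(60L³√F̂/√2)·(1 + ‖a‖/|re a|)·(1 + ‖a‖/‖im a‖)` of an exactly flat leader configuration
# (free-hands support of ⟨stmt-QuantumFields-24197⟩ `SwapVirialDeficit.SwapGluedStiffness`; ✓`exists_flat_near_bulk` read through the master chart: the hub leader is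
# `ν(axisPoint a) = (re a, ‖im a‖, 0, 0)/‖a‖` (✓`su2Quat_gnoLeader_three`, ✓`axisUnit_components`) — the form the (S-core) matching on hub shells `τ ≤ ψ ≤ π/2 − τ` consumes)

* ★★ `exists_flat_near_gnomonic (ha : a.re ≠ 0) (hi : a.im ≠ 0) (ε) (η)`.

HONEST LABEL: a corollary; stubs of ➎, ⟨24197⟩ ∕ ⟨24194⟩ ∕ ⟨24497⟩ OPEN; own crux ⟨22884⟩ OPEN (blocked-on ⟨19935⟩); the Yang–Mills mass gap is NOT proved; no summit is proved by a line.
THEOREMS ONLY (0 `def`, 0 `sorry`), standard axioms.  Width seat ym-line-sfw-p2-w3 g66 (cell ym-idea-1, free hands), `--supports stmt-QuantumFields-24197`.  References: [cite: Luscher1983, §2]; [folklore].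
-/

set_option autoImplicit false

noncomputable section

open Quaternion
open scoped Quaternion
open Literature.MathematicalPhysics.QuantumFieldTheory hiding SU2
open Literature.MathematicalPhysics.QuantumLattice
open Literature.Analysis.Calculus (radialUnit)
open Summit.QuantumFields.YangMills.Theorems.SwapTwistDeficit.ToronLog (axisPoint)

namespace Summit.QuantumFields.YangMills.Theorems.SwapVirialDeficit.NearFlat

open Summit.QuantumFields.YangMills.Theorems.FemtoTransferGap
open Summit.QuantumFields.YangMills.Theorems.FemtoTransferGap.TT
open Summit.QuantumFields.YangMills.Theorems.VirialFluxGap.RingDeficit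
open Summit.QuantumFields.YangMills.Theorems.SwapVirialDeficit.SwapRing
open Summit.QuantumFields.YangMills.Theorems.SwapVirialDeficit.BlowUpRing

variable {L : ℕ} [NeZero L]

/-- ★★ **NEAR-FLAT PROJECTION IN GNOMONIC∕HUB LETTERS** (principal sector; bulk hub `re a ≠ 0`, `im a ≠ 0`): the leader configuration of the chart point `(a, ε, η)` is within
`(60L³√F̂/√2)·(1 + ‖a‖/|re a|)·(1 + ‖a‖/‖im a‖)` (each leader, quaternion norm) of an exactly flat one with followers `1`. [cite: Luscher1983, §2] -/
theorem exists_flat_near_gnomonic {a : ℍ} (ha : a.re ≠ 0) (hi : a.im ≠ 0) (ε : GnoSign L) (η : GnoCoord L) :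
    ∃ qf : (Fin 4 → SU2) × (Fol L → SU2), chartDeficit L (fun _ => false) (fun _ => 1) qf = 0 ∧ (∀ i, qf.2 i = 1) ∧
      ∀ k, ‖su2Quat ((blowUpPoint (L := L) 1 (gnomonicPoint a ε η)).1 k) - su2Quat (qf.1 k)‖ ≤
        (60 * (L : ℝ) ^ 3 * Real.sqrt (gnoDeficit (fun _ => false) (fun _ => 1) a ε η) / Real.sqrt 2) *
          (1 + ‖a‖ / |a.re|) * (1 + ‖a‖ / ‖a.im‖) := by
  have ha0 : a ≠ 0 := by intro h; apply hi; rw [h]; rfl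
  have han : 0 < ‖a‖ := norm_pos_iff.2 ha0
  set q := blowUpPoint (L := L) 1 (gnomonicPoint a ε η) with hq
  have h3 : su2Quat (q.1 3) = radialUnit (axisPoint a) := su2Quat_gnoLeader_three ha0 ε η
  obtain ⟨hAre, hAimI, hAimJ, hAimK⟩ := axisUnit_components a
  -- the hub leader's real part and imaginary norm
  have hre3 : (su2Quat (q.1 3)).re = ‖a‖⁻¹ * a.re := by rw [h3, hAre]
  have him3 : ‖(su2Quat (q.1 3)).im‖ = ‖a‖⁻¹ * ‖a.im‖ := by
    have e : ‖(radialUnit (axisPoint a)).im‖ ^ 2 = (‖a‖⁻¹ * ‖a.im‖) ^ 2 := by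
      rw [Literature.MathematicalPhysics.QuantumLattice.sq_norm_eq_sum_sq]
      simp only [Quaternion.re_im, Quaternion.imI_im, Quaternion.imJ_im, Quaternion.imK_im, hAimI, hAimJ, hAimK]
      ring
    rw [h3]
    have h1 : 0 ≤ ‖(radialUnit (axisPoint a)).im‖ := norm_nonneg _
    have h2 : 0 ≤ ‖a‖⁻¹ * ‖a.im‖ := by positivity
    nlinarith [e, h1, h2]
  have hre' : (su2Quat (q.1 3)).re ≠ 0 := by rw [hre3]; exact mul_ne_zero (inv_ne_zero han.ne') ha
  have him' : (su2Quat (q.1 3)).im ≠ 0 := by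
    intro h0; have := him3; rw [h0, norm_zero] at this
    exact (mul_ne_zero (inv_ne_zero han.ne') (norm_ne_zero_iff.2 hi)) this.symm
  obtain ⟨qf, hflat, hfol, hdist⟩ := exists_flat_near_bulk (L := L) q hre' him'
  refine ⟨qf, hflat, hfol, fun k => (hdist k).trans (le_of_eq ?_)⟩
  have e1 : |(su2Quat (q.1 3)).re| = |a.re| / ‖a‖ := by rw [hre3, abs_mul, abs_inv, abs_norm]; ring
  have e2 : ‖(su2Quat (q.1 3)).im‖ = ‖a.im‖ / ‖a‖ := by rw [him3]; ring
  rw [e1, e2]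
  have hra : 0 < |a.re| := abs_pos.2 ha
  have hia : 0 < ‖a.im‖ := norm_pos_iff.2 hi
  unfold gnoDeficit
  rw [← hq]
  field_simp

end Summit.QuantumFields.YangMills.Theorems.SwapVirialDeficit.NearFlat

end
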